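import Summits.BirchSwinnertonDyer.Rank1Residual.X11b.CongruenceLimitCoinvariants
import Summits.BirchSwinnertonDyer.Rank1Residual.X11b.InvariantsSocleCriterion
import HarnessLib

/-!
# X11b, routes R1/p2 — the ONE-SIDED Selmer end form: Lemma 2.1 (socle hypotheses) + (b) + the
# Greenberg-side divisibility for the `g_m` + (c) ⟹ `Fitt_Λ(Sel(M_f)^∨) ⊆ (L)`, its coinvariant
# form at `𝟙`, and the `Ch`-form over `Λ_𝒪`

HONEST FRAMING (cell `b2b-bsdres`, run/shared/lean/b2b/bsd-rank1-residual/, verbatim in every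
file): the goal of the cell is to DELETE the COMBINATION-SHAPED residual classes of the
Birch–Swinnerton-Dyer formula for ALL analytic-rank `≤ 1` elliptic curves over `ℚ` — "full BSD
formula for every rank `≤ 1` curve in class `C`" assembled STRICTLY from published theorems — so
that the rank-`≤ 1` remainder becomes exactly the CONSTRUCTION-SHAPED classes, which are TYPED
(missing-input `Prop`s), NOT attempted. This is not "finishing BSD". Sub-cell
`b2b-bsdres-multr1-p1` (X11b via the re-proof of Castella 2018 Thm. A along the author's erratum):
a RESEARCH ROUTE; no claim beyond the stated class; X11b stays CONSTRUCTION-SHAPED; nothing here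
changes a label; no named fact is introduced (theorems only; no `sorry`).

## What this file kernel-checks

The one-sided companion of `CastellaErratumSelmerCongruence.lean` (gen 4, two-sided): the whole
passage "(b), Lemma 2.1, and basic properties of Fitting ideals … [Ski16, p. 192]" of the erratum
(p. 4), read with ONLY the Greenberg-side input for the approximating forms. Inputs, all in the
erratum's printed form:
* objects: a coefficient ring `R` (`Λ_𝒪`, `Λ_𝒪^{ur}`) with `a ∈ Jac(R)` (`p`, `ϖ`) and an ideal `I`
  (`𝔪 = (ϖ, T)`); Selmer data `(Γ, φ_v : Γ_v → Γ, L)` (`G_{K,S}`, `G_{K_𝔭̄}`, `L = {𝔭̄}`); discrete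
  `R`-linear `Γ`-modules `M_f`, `M_{g_m}` (`T ⊗ Λ^*`), `a`-divisible and `I`-primary;
* Lemma 2.1's hypotheses in SOCLE form (`InvariantsSocleCriterion.lean`): no nonzero `Γ`-invariant
  and no nonzero `Γ_v`-invariant (`v ∈ L`) in the socles `M[I]` (`≅ ρ̄_g`: irreducibility of
  `ρ̄|_{G_K}`, and `H⁰(ℚ_p, ρ̄) = 0` = hypothesis (iv) `E(ℚ_p)[p] = 0`);
* `θ m : M_{g_m}[a^m] ≅ M_f[a^m]` [(b), Hida theory];
* `hF m : Fitt_R(Sel(M_{g_m})^∨) ⊆ (L_m)` — from (2.5) for `g_m` AS PRINTED ("`Ch ⊆ (L_m)`" when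
  torsion), by `CongruenceLimit.fittingIdeal_zero_le_of_charIdeal_le` [⇐ [FW21, Thm. 4.41] for the
  crystalline `g_m` + [FO12, 7.2.1], [CGS23, 1.4.5], [JSW17, 3.4.2]];
* `hc m : (L_m) + (a^m) = (L) + (a^m)` [(c), [Cas20, Thm. 2.11]].
Outputs: `fittingIdeal_le_span_of_selmer_congruences_of_socle` — `Fitt_R(Sel(M_f)^∨) ⊆ (L)`;
`length_quotient_le_length_baseChange_of_selmer_congruences` — for every DVR `R`-algebra `S`
(evaluation at `𝟙`): `length_S(S/(L(𝟙))) ≤ length_S(S ⊗_R Sel(M_f)^∨)` = "`ord L^Σ_p(f)(𝟙) ≤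
ord #X_Γ`", NO further input; and over `Λ_𝒪 = 𝒪⟦T⟧` with `X = Sel(M_f)^∨` torsion [control, Cas18
Thm. 2.3] and without nonzero finite submodule [JSW17 Prop. "no pseudo-null" (arXiv:1512.06894
§3.3.6 Prop. 13) under (sst) — PUB at `p ∥ N`]: `powerSeries_charIdeal_le_span_of_selmer_congruences`
— `Ch_Λ(X) ⊆ (L)`. NOT used anywhere: `L ≠ 0`, torsionness or Lemma 2.2 for the `g_m`, the
Euler-system divisibility (2.3) ([CH18], [LV19], [CGS23 5.5.1], [BCK21]). What stays dictionary:
the objects and the identifications `M[𝔪] ≅ ρ̄`, `Sel^Σ_𝔭̄ ⊂ H¹(G_{K,S}, ·)` — as in gen 4.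

References: [Castella2018Erratum] Lemma 2.1, p. 4; [Skinner2016PacificMC] §3.1; [FouquetWan2021]
Thm. 4.41; [JetchevSkinnerWan2017] §3.3, Cor. 3.4.2.
-/

noncomputable section

open CategoryTheory Literature.NumberTheory.GaloisRepresentations Literature.RingTheory.FittingIdeal
  Literature.NumberTheory.EllipticCurves Literature.NumberTheory.EllipticCurves.Module

open scoped ContRepresentation TensorProduct

universe u v

namespace Summit.BirchSwinnertonDyer.Rank1Residual.X11b.TorsionControl

variable {R : Type u} [CommRing R] [TopologicalSpace R]
variable {Γ : Type u} [Group Γ] [TopologicalSpace Γ] [IsTopologicalGroup Γ]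
variable {ι : Type*} {Γv : ι → Type u} [∀ v, Group (Γv v)] [∀ v, TopologicalSpace (Γv v)]
  [∀ v, IsTopologicalGroup (Γv v)] (φ : ∀ v, Γv v →ₜ* Γ) (L : Set ι)

/-- **(b) + Lemma 2.1 (socle hypotheses) ⟹ `Sel(M_f)[a^m] ≃ Sel(M_g)[a^m]`** — the socle
variant of `nonempty_torsionBy_selmer_equiv` (gen 4): the `H⁰`-vanishings are discharged by
`invariants_eq_bot_of_idealTorsion` from `I`-primarity and the absence of invariants in the socles.
[cite: Castella2018Erratum, Lemma 2.1 and proof of Thm. 1.1 (b)] -/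
theorem nonempty_torsionBy_selmer_equiv_of_socle (a : R) (I : Ideal R) (m : ℕ) {Mf : Type u}
    [AddCommGroup Mf] [Module R Mf] [TopologicalSpace Mf] [DiscreteTopology Mf]
    [ContinuousSMul R Mf] {Mg : Type u} [AddCommGroup Mg] [Module R Mg] [TopologicalSpace Mg]
    [DiscreteTopology Mg] [ContinuousSMul R Mg] (ρf : ContinuousRep Γ R Mf)
    (ρg : ContinuousRep Γ R Mg)
    (hdivf : Function.Surjective fun x : Mf => a • x)
    (hprimf : ∀ x : Mf, ∃ n : ℕ, ∀ b ∈ I ^ n, b • x = 0)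
    (hsocf : ∀ x : Mf, (∀ b ∈ I, b • x = 0) → (∀ g : Γ, ρf g x = x) → x = 0)
    (hsoclf : ∀ v ∈ L, ∀ x : Mf, (∀ b ∈ I, b • x = 0) → (∀ h : Γv v, ρf (φ v h) x = x) → x = 0)
    (hdivg : Function.Surjective fun x : Mg => a • x)
    (hprimg : ∀ x : Mg, ∃ n : ℕ, ∀ b ∈ I ^ n, b • x = 0)
    (hsocg : ∀ x : Mg, (∀ b ∈ I, b • x = 0) → (∀ g : Γ, ρg g x = x) → x = 0)
    (hsoclg : ∀ v ∈ L, ∀ x : Mg, (∀ b ∈ I, b • x = 0) → (∀ h : Γv v, ρg (φ v h) x = x) → x = 0)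
    (θ : (torsionRep ρg (a ^ m)).toTopRep ≅ (torsionRep ρf (a ^ m)).toTopRep) :
    Nonempty (Submodule.torsionBy R (selmer φ L ρf) (a ^ m) ≃ₗ[R]
      Submodule.torsionBy R (selmer φ L ρg) (a ^ m)) :=
  nonempty_torsionBy_selmer_equiv φ L a m ρf ρg hdivf
    (invariants_eq_bot_of_idealTorsion ρf I hprimf hsocf)
    (fun v hv => invariants_eq_bot_of_idealTorsion (ρf.restrict (φ v)) I hprimf
      (fun x hI hfix => hsoclf v hv x hI (fun h => by simpa using hfix h)))
    hdivg (invariants_eq_bot_of_idealTorsion ρg I hprimg hsocg)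
    (fun v hv => invariants_eq_bot_of_idealTorsion (ρg.restrict (φ v)) I hprimg
      (fun x hI hfix => hsoclg v hv x hI (fun h => by simpa using hfix h)))
    θ

section OneSided

variable (a : R) (I : Ideal R)
  {Mf : Type u} [AddCommGroup Mf] [Module R Mf] [TopologicalSpace Mf] [DiscreteTopology Mf]
  [ContinuousSMul R Mf] (ρf : ContinuousRep Γ R Mf)
  (Mg : ℕ → Type u) [∀ m, AddCommGroup (Mg m)] [∀ m, Module R (Mg m)]
  [∀ m, TopologicalSpace (Mg m)] [∀ m, DiscreteTopology (Mg m)] [∀ m, ContinuousSMul R (Mg m)]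
  (ρg : ∀ m, ContinuousRep Γ R (Mg m))

/-- **The one-sided Selmer end form (Fitting).** With the dictionary of the module docstring:
Lemma 2.1 (socle hypotheses) for `M_f` and the `M_{g_m}`, (b) `θ m`, the ONE-SIDED input
`hF m : Fitt_R(Sel(M_{g_m})^∨) ⊆ (L_m)` and (c) `hc m` give `Fitt_R(Sel(M_f)^∨) ⊆ (L)` — for any
Noetherian `R` with `a ∈ Jac(R)`. No `L ≠ 0`, no torsionness, no Lemma 2.2, no Euler system.
[cite: Castella2018Erratum, proof of Thm. 1.1 (p. 4), read one-sidedly] [cite: Skinner2016PacificMC, §3.1 (p. 192)] -/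
theorem fittingIdeal_le_span_of_selmer_congruences_of_socle [IsNoetherianRing R]
    (ha : Ideal.span {a} ≤ (⊥ : Ideal R).jacobson)
    (hdivf : Function.Surjective fun x : Mf => a • x)
    (hprimf : ∀ x : Mf, ∃ n : ℕ, ∀ b ∈ I ^ n, b • x = 0)
    (hsocf : ∀ x : Mf, (∀ b ∈ I, b • x = 0) → (∀ g : Γ, ρf g x = x) → x = 0)
    (hsoclf : ∀ v ∈ L, ∀ x : Mf, (∀ b ∈ I, b • x = 0) → (∀ h : Γv v, ρf (φ v h) x = x) → x = 0)
    (hdivg : ∀ m, 1 ≤ m → Function.Surjective fun x : Mg m => a • x)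
    (hprimg : ∀ m, 1 ≤ m → ∀ x : Mg m, ∃ n : ℕ, ∀ b ∈ I ^ n, b • x = 0)
    (hsocg : ∀ m, 1 ≤ m → ∀ x : Mg m, (∀ b ∈ I, b • x = 0) → (∀ g : Γ, ρg m g x = x) → x = 0)
    (hsoclg : ∀ m, 1 ≤ m → ∀ v ∈ L, ∀ x : Mg m, (∀ b ∈ I, b • x = 0) →
      (∀ h : Γv v, ρg m (φ v h) x = x) → x = 0)
    (θ : ∀ m, 1 ≤ m → ((torsionRep (ρg m) (a ^ m)).toTopRep ≅ (torsionRep ρf (a ^ m)).toTopRep))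
    [Module.Finite R (CharacterModule (selmer φ L ρf))]
    [∀ m, Module.Finite R (CharacterModule (selmer φ L (ρg m)))]
    {Lf : R} (Lg : ℕ → R)
    (hF : ∀ m, 1 ≤ m →
      Module.fittingIdeal R (CharacterModule (selmer φ L (ρg m))) 0 ≤ Ideal.span {Lg m})
    (hc : ∀ m, 1 ≤ m →
      Ideal.span {Lg m} ⊔ (Ideal.span {a}) ^ m = Ideal.span {Lf} ⊔ (Ideal.span {a}) ^ m) :
    Module.fittingIdeal R (CharacterModule (selmer φ L ρf)) 0 ≤ Ideal.span {Lf} := by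
  refine CongruenceLimit.fittingIdeal_le_span_of_congruences (Ideal.span {a})
    (fun m => CharacterModule (selmer φ L (ρg m))) Lg ha (fun m hm => ?_) hF hc
  exact Classical.choice (PontryaginCongruence.nonempty_quotIdealPow_equiv_of_torsionBy_equiv a m
    (Classical.choice (nonempty_torsionBy_selmer_equiv_of_socle φ L a I m ρf (ρg m) hdivf hprimf
      hsocf hsoclf (hdivg m hm) (hprimg m hm) (hsocg m hm) (hsoclg m hm) (θ m hm))))

/-- **The one-sided Selmer end form at the trivial character (coinvariants).** Same inputs; for
every discrete valuation ring `S` that is an `R`-algebra (`S = Λ/(T) = 𝒪`, `R₀`: evaluation at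
`𝟙`), `length_S(S/(L(𝟙))) ≤ length_S(S ⊗_R Sel(M_f)^∨)` — i.e. `ord L^Σ_p(f)(𝟙) ≤ ord #X^Σ_ac(E[p^∞])_Γ`,
the quantity Greenberg's control theorem ([JSW17, §3.3]) computes. No input on `Sel(M_f)^∨`
beyond finite generation. [cite: Castella2018Erratum, proof of Thm. 1.1 (p. 4), read one-sidedly at the trivial character]
[cite: JetchevSkinnerWan2017, §7.4.1 (the lower bound from the Greenberg-side divisibility)] -/
theorem length_quotient_le_length_baseChange_of_selmer_congruences [IsNoetherianRing R]
    (S : Type v) [CommRing S] [Algebra R S] [IsDomain S] [IsDiscreteValuationRing S]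
    (ha : Ideal.span {a} ≤ (⊥ : Ideal R).jacobson)
    (hdivf : Function.Surjective fun x : Mf => a • x)
    (hprimf : ∀ x : Mf, ∃ n : ℕ, ∀ b ∈ I ^ n, b • x = 0)
    (hsocf : ∀ x : Mf, (∀ b ∈ I, b • x = 0) → (∀ g : Γ, ρf g x = x) → x = 0)
    (hsoclf : ∀ v ∈ L, ∀ x : Mf, (∀ b ∈ I, b • x = 0) → (∀ h : Γv v, ρf (φ v h) x = x) → x = 0)
    (hdivg : ∀ m, 1 ≤ m → Function.Surjective fun x : Mg m => a • x)
    (hprimg : ∀ m, 1 ≤ m → ∀ x : Mg m, ∃ n : ℕ, ∀ b ∈ I ^ n, b • x = 0)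
    (hsocg : ∀ m, 1 ≤ m → ∀ x : Mg m, (∀ b ∈ I, b • x = 0) → (∀ g : Γ, ρg m g x = x) → x = 0)
    (hsoclg : ∀ m, 1 ≤ m → ∀ v ∈ L, ∀ x : Mg m, (∀ b ∈ I, b • x = 0) →
      (∀ h : Γv v, ρg m (φ v h) x = x) → x = 0)
    (θ : ∀ m, 1 ≤ m → ((torsionRep (ρg m) (a ^ m)).toTopRep ≅ (torsionRep ρf (a ^ m)).toTopRep))
    [Module.Finite R (CharacterModule (selmer φ L ρf))]
    [∀ m, Module.Finite R (CharacterModule (selmer φ L (ρg m)))]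
    {Lf : R} (Lg : ℕ → R)
    (hF : ∀ m, 1 ≤ m →
      Module.fittingIdeal R (CharacterModule (selmer φ L (ρg m))) 0 ≤ Ideal.span {Lg m})
    (hc : ∀ m, 1 ≤ m →
      Ideal.span {Lg m} ⊔ (Ideal.span {a}) ^ m = Ideal.span {Lf} ⊔ (Ideal.span {a}) ^ m) :
    Module.length S (S ⧸ Ideal.span {algebraMap R S Lf}) ≤
      Module.length S (S ⊗[R] CharacterModule (selmer φ L ρf)) :=
  CongruenceLimit.length_quotient_span_le_length_baseChange S
    (fittingIdeal_le_span_of_selmer_congruences_of_socle φ L a I ρf Mg ρg ha hdivf hprimf hsocf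
      hsoclf hdivg hprimg hsocg hsoclg θ Lg hF hc)

end OneSided

/-! ### Over `Λ_𝒪 = 𝒪⟦T⟧`: the `Ch`-form with the two published inputs on `X = Sel(M_f)^∨` -/

section PowerSeries

variable {𝒪 : Type} [CommRing 𝒪] [IsDomain 𝒪] [IsDiscreteValuationRing 𝒪]
  [IsAdicComplete (IsLocalRing.maximalIdeal 𝒪) 𝒪] [TopologicalSpace (PowerSeries 𝒪)]
variable {Γ₀ : Type} [Group Γ₀] [TopologicalSpace Γ₀] [IsTopologicalGroup Γ₀]
variable {ι₀ : Type*} {Γw : ι₀ → Type} [∀ v, Group (Γw v)] [∀ v, TopologicalSpace (Γw v)]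
  [∀ v, IsTopologicalGroup (Γw v)] (ψ : ∀ v, Γw v →ₜ* Γ₀) (L₀ : Set ι₀)

/-- **`Ch_Λ(Sel(M_f)^∨) ⊆ (L)` over `Λ_𝒪 = 𝒪⟦T⟧` from the Greenberg side for the `g_m`, all
inputs PRINTED**: Lemma 2.1 (socle form) for `M_f`, `M_{g_m}`; (b) `θ m`; `hCh m` = (2.5) for
`g_m` in the shape [FW21, Thm. 4.41] prints it ("`Ch ⊆ (L_m)`" for torsion modules); (c) `hc`;
and on `X = Sel(M_f)^∨`: `hT` [torsion — Cas18 Thm. 2.3 (control) given `rank E(K) = 1`,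
`#Ш(E/K)[p^∞] < ∞`] and `hnf` [no nonzero finite-length submodule — [JSW17] §3.3.6 Prop. 13
under (sst), PUB at `p ∥ N`]. Output: `Fitt_Λ(X) = Ch_Λ(X) ⊆ (L)`, whence route p2's
`IMCLowerAtTrivialChar` by `CongruenceLimit.addVal_constantCoeff_le_of_span_le`. Universe `Type`.
[cite: Castella2018Erratum, Lemma 2.1 and proof of Thm. 1.1 (p. 4), read one-sidedly]
[cite: JetchevSkinnerWan2017, §3.3.6 Prop. 13 (no pseudo-null submodule)] -/
theorem powerSeries_charIdeal_le_span_of_selmer_congruences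
    (a : PowerSeries 𝒪) (ha : Ideal.span {a} ≤ (⊥ : Ideal (PowerSeries 𝒪)).jacobson)
    (I : Ideal (PowerSeries 𝒪))
    {Mf : Type} [AddCommGroup Mf] [Module (PowerSeries 𝒪) Mf] [TopologicalSpace Mf]
    [DiscreteTopology Mf] [ContinuousSMul (PowerSeries 𝒪) Mf] (ρf : ContinuousRep Γ₀ (PowerSeries 𝒪) Mf)
    (hdivf : Function.Surjective fun x : Mf => a • x)
    (hprimf : ∀ x : Mf, ∃ n : ℕ, ∀ b ∈ I ^ n, b • x = 0)
    (hsocf : ∀ x : Mf, (∀ b ∈ I, b • x = 0) → (∀ g : Γ₀, ρf g x = x) → x = 0)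
    (hsoclf : ∀ v ∈ L₀, ∀ x : Mf, (∀ b ∈ I, b • x = 0) → (∀ h : Γw v, ρf (ψ v h) x = x) → x = 0)
    (Mg : ℕ → Type) [∀ m, AddCommGroup (Mg m)] [∀ m, Module (PowerSeries 𝒪) (Mg m)]
    [∀ m, TopologicalSpace (Mg m)] [∀ m, DiscreteTopology (Mg m)]
    [∀ m, ContinuousSMul (PowerSeries 𝒪) (Mg m)] (ρg : ∀ m, ContinuousRep Γ₀ (PowerSeries 𝒪) (Mg m))
    (hdivg : ∀ m, 1 ≤ m → Function.Surjective fun x : Mg m => a • x)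
    (hprimg : ∀ m, 1 ≤ m → ∀ x : Mg m, ∃ n : ℕ, ∀ b ∈ I ^ n, b • x = 0)
    (hsocg : ∀ m, 1 ≤ m → ∀ x : Mg m, (∀ b ∈ I, b • x = 0) → (∀ g : Γ₀, ρg m g x = x) → x = 0)
    (hsoclg : ∀ m, 1 ≤ m → ∀ v ∈ L₀, ∀ x : Mg m, (∀ b ∈ I, b • x = 0) →
      (∀ h : Γw v, ρg m (ψ v h) x = x) → x = 0)
    (θ : ∀ m, 1 ≤ m → ((torsionRep (ρg m) (a ^ m)).toTopRep ≅ (torsionRep ρf (a ^ m)).toTopRep))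
    [Module.Finite (PowerSeries 𝒪) (CharacterModule (selmer ψ L₀ ρf))]
    [∀ m, Module.Finite (PowerSeries 𝒪) (CharacterModule (selmer ψ L₀ (ρg m)))]
    {Lf : PowerSeries 𝒪} (Lg : ℕ → PowerSeries 𝒪)
    (hCh : ∀ m, 1 ≤ m → Module.IsTorsion (PowerSeries 𝒪) (CharacterModule (selmer ψ L₀ (ρg m))) →
      charIdeal (PowerSeries 𝒪) (CharacterModule (selmer ψ L₀ (ρg m))) ≤ Ideal.span {Lg m})
    (hc : ∀ m, 1 ≤ m →
      Ideal.span {Lg m} ⊔ (Ideal.span {a}) ^ m = Ideal.span {Lf} ⊔ (Ideal.span {a}) ^ m)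
    (hT : Module.IsTorsion (PowerSeries 𝒪) (CharacterModule (selmer ψ L₀ ρf)))
    (hnf : ∀ N' : Submodule (PowerSeries 𝒪) (CharacterModule (selmer ψ L₀ ρf)),
      Module.length (PowerSeries 𝒪) N' ≠ ⊤ → N' = ⊥) :
    Module.fittingIdeal (PowerSeries 𝒪) (CharacterModule (selmer ψ L₀ ρf)) 0 =
        charIdeal (PowerSeries 𝒪) (CharacterModule (selmer ψ L₀ ρf)) ∧
      charIdeal (PowerSeries 𝒪) (CharacterModule (selmer ψ L₀ ρf)) ≤ Ideal.span {Lf} := by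
  have hFitt : Module.fittingIdeal (PowerSeries 𝒪) (CharacterModule (selmer ψ L₀ ρf)) 0 ≤
      Ideal.span {Lf} :=
    fittingIdeal_le_span_of_selmer_congruences_of_socle ψ L₀ a I ρf Mg ρg ha hdivf hprimf hsocf
      hsoclf hdivg hprimg hsocg hsoclg θ Lg
      (fun m hm => CongruenceLimit.fittingIdeal_zero_le_of_charIdeal_le (hCh m hm)) hc
  have hFC := CongruenceLimit.PowerSeriesDVR.fittingIdeal_zero_eq_charIdeal_of_forall_length
    (CharacterModule (selmer ψ L₀ ρf)) hT hnf
  exact ⟨hFC, hFC ▸ hFitt⟩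

end PowerSeries

end Summit.BirchSwinnertonDyer.Rank1Residual.X11b.TorsionControl

end
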